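import Summits.Langlands.Langlands.Theses.SenNullAlignment
import HarnessLib

/-!
# Birth skeleton (BC3) for the piece `CanonicalReciprocityData` of the BC2 redirect of
# `SenNullAlignment.SectorComplement` (stmt-Langlands-16308) — line `birth_CanonicalReciprocityData`

The piece is the summit's non-vacuity conjunct (VERBATIM the shared item stmt-Langlands-17930): PINNED reciprocity data exist.
In print textbook-grade (Harris–Taylor Thm A is stated for Art_K of local class field theory, Deligne's constants for THE
Artin maps); in the tree three named-fact-shaped inputs, which are the stubs:
* `stub_localLanglandsDatumNonempty` (the body of the named fact `LocalLanglandsDatum.nonempty`: SOME lawfully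
  normalised datum at every local field — supplies the threaded `LocalGaloisGroup` facts `hmul … hqc`);
* `stub_canonicalEpsilonSystem` (Deligne 1973 Thm 4.1 for THE canonical Artin maps: an ε-system all of whose Artin data
  are canonical — the sharpening of `nonempty_localEpsilonSystem` its own docstring describes);
* `stub_localLanglandsGLCanonical` (the named fact `localLanglands_gl` at CANONICAL normalising pairs — Harris–Taylor
  Thm A + Henniart 1993 exactly as printed; weaker than the sibling line's stub S6, which asserts it for every pair).
`CanonicalReciprocityData_of` builds the datum completion by completion (choice over the finite places).

Shape (for `ledger skeleton check`): named stubs `theorem stub_<name> : <Prop> := by sorry` (the ONLY sorries),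
`_Goal.stub_<name> : Prop := type_of% @stub_<name>`, and `CanonicalReciprocityData_of (h₁ : _Goal.stub_…) … : CanonicalReciprocityData` concluding
the piece BY NAME (real proof); the last `example` feeds the stubs to it.  PRE-SPLIT VERSION: the piece is not yet a
decl of the route file, so it is declared here, VERBATIM the text filed in children.json, inside the route namespace;
after `route edit --split` lands it, delete section `0` and this file refers to the route decl unchanged.
-/

noncomputable section

set_option linter.dupNamespace false

/-! ## 0. The piece, verbatim (pre-split stand-in for the route decl) -/

namespace Summit.Langlands.Langlands.Theses.SenNullAlignment

open scoped BigOperators Topology Manifold Classical MeasureTheory ProbabilityTheory Matrix InnerProductSpace ComplexConjugate ContinuousMap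
open Filter Set Function TopologicalSpace MeasureTheory

/-- **P4 — pinned reciprocity data exist** (verbatim stmt-Langlands-17930) (children.json text, verbatim). -/
def CanonicalReciprocityData : Prop :=
  ∀ (F : Type) [Field F] [NumberField F], Nonempty (Summit.Langlands.ReciprocityData F)

end Summit.Langlands.Langlands.Theses.SenNullAlignment

namespace Summit.Langlands.Langlands.Cruxes.CanonicalReciprocityData.Birth

open scoped MatrixGroups Matrix Classical Polynomial NumberField BigOperators Topology
open Filter IsDedekindDomain
open Literature.NumberTheory.Automorphic Literature.NumberTheory.GaloisRepresentations
open Summit.Langlands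
open Summit.Langlands.Langlands.Theses.SenNullAlignment (CanonicalReciprocityData)

/-! ## 1. The stubs (the ONLY sorries of this file) -/

/-- **stub N₀ — some local Langlands datum exists at every non-archimedean local field** (the body of the named fact
`LocalLanglandsDatum.nonempty`: Harris–Taylor 2001 Thm A, Henniart 2000 Thm 1.2, with local class field theory and
Deligne's constants, lawfully but not necessarily canonically normalised). [cite: HarrisTaylorAMS2001, Thm. A] -/
theorem stub_localLanglandsDatumNonempty : ∀ (E : Type) [Field E] [ValuativeRel E] [TopologicalSpace E] [IsNonarchimedeanLocalField E], Nonempty (Literature.NumberTheory.Automorphic.LocalLanglandsDatum E) := by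
  sorry

/-- **stub 𝓔 — a system of local constants normalised against THE canonical Artin maps** (Deligne 1973 Thm 4.1 /
Langlands 1970 / Tate 1979 (3.4.1): Deligne's `ε(V, ψ, dx)` IS defined against `Art_E` of local class field theory at
every finite extension). [cite: Deligne1973, Thm. 4.1] [cite: TateCorvallis1979, (3.4.1)] -/
theorem stub_canonicalEpsilonSystem : ∀ (E : Type) [Field E] [ValuativeRel E] [TopologicalSpace E] [IsNonarchimedeanLocalField E], ∃ 𝓔 : Literature.NumberTheory.Automorphic.LocalEpsilonSystem E, (𝓔.artin E).IsCanonical ∧ ∀ (E' : Type) [Field E'] [ValuativeRel E'] [TopologicalSpace E'] [IsNonarchimedeanLocalField E'] [Algebra E E'] [FiniteDimensional E E'], (𝓔.artin E').IsCanonical := by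
  sorry

/-- **stub HT — the local Langlands correspondence for `GL_n` at CANONICAL normalising pairs** (the named fact
`localLanglands_gl` — Harris–Taylor 2001 Thm A with Henniart's 1993 uniqueness on supercuspidals — asserted only for
local Artin data that ARE the canonical Artin map, exactly as printed). [cite: HarrisTaylorAMS2001, Thm. A]
[cite: Henniarts1993, Thm 1.1] -/
theorem stub_localLanglandsGLCanonical : ∀ (E : Type) [Field E] [ValuativeRel E] [TopologicalSpace E] [IsNonarchimedeanLocalField E] (hmul : IsFrobPow.mul (F := E)) (huniq : IsFrobPow.unique (F := E)) (hn : absInertia_normal E) (hex : exists_isFrobPow (F := E)) (hns : WeilGroup.exists_subgroup_le_inertia_isOpen_of_continuous (F := E)) (d : LocalArtinData E) (𝓔 : Literature.NumberTheory.Automorphic.LocalEpsilonSystem E) (hd : 𝓔.artin E = d), d.IsCanonical → localLanglands_gl E hmul huniq hn hex hns d 𝓔 hd := by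
  sorry

/-! ## 2. The stub statements as named propositions -/

namespace _Goal

/-- The statement of `stub_localLanglandsDatumNonempty` (literally its type). [folklore] -/
def stub_localLanglandsDatumNonempty : Prop :=
  type_of% @Summit.Langlands.Langlands.Cruxes.CanonicalReciprocityData.Birth.stub_localLanglandsDatumNonempty

/-- The statement of `stub_canonicalEpsilonSystem` (literally its type). [folklore] -/
def stub_canonicalEpsilonSystem : Prop :=
  type_of% @Summit.Langlands.Langlands.Cruxes.CanonicalReciprocityData.Birth.stub_canonicalEpsilonSystem

/-- The statement of `stub_localLanglandsGLCanonical` (literally its type). [folklore] -/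
def stub_localLanglandsGLCanonical : Prop :=
  type_of% @Summit.Langlands.Langlands.Cruxes.CanonicalReciprocityData.Birth.stub_localLanglandsGLCanonical

end _Goal

/-! ## 3. The composition (kernel-checked, no `sorry`) -/

/-- **`CanonicalReciprocityData` from its three stubs**: at each completion take the threaded facts of SOME datum (N₀),
a canonically normalised ε-system (𝓔), its base Artin datum (canonical), and `rec` from Harris–Taylor at that canonical
pair (HT); then choose over the finite places. -/
theorem CanonicalReciprocityData_of (h0 : _Goal.stub_localLanglandsDatumNonempty) (h1 : _Goal.stub_canonicalEpsilonSystem)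
    (h2 : _Goal.stub_localLanglandsGLCanonical) : CanonicalReciprocityData := by
  dsimp only [_Goal.stub_localLanglandsDatumNonempty, _Goal.stub_canonicalEpsilonSystem,
    _Goal.stub_localLanglandsGLCanonical] at h0 h1 h2
  intro F _ _
  have key : ∀ v : HeightOneSpectrum (𝓞 F), ∃ D : LocalLanglandsDatum (v.adicCompletion F),
      D.artin.IsCanonical ∧ ∀ (E : Type) [Field E] [ValuativeRel E] [TopologicalSpace E] [IsNonarchimedeanLocalField E]
        [Algebra (v.adicCompletion F) E] [FiniteDimensional (v.adicCompletion F) E], (D.eps.artin E).IsCanonical := by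
    intro v
    obtain ⟨D₀⟩ := h0 (v.adicCompletion F)
    obtain ⟨𝓔, hcan, hcanE⟩ := h1 (v.adicCompletion F)
    obtain ⟨rec, hrec, -⟩ := h2 (v.adicCompletion F) D₀.hmul D₀.huniq D₀.hn D₀.hex D₀.hns (𝓔.artin _) 𝓔 rfl hcan
    exact ⟨⟨D₀.hmul, D₀.huniq, D₀.hn, D₀.hex, D₀.hns, D₀.hqc, 𝓔.artin _, 𝓔, rfl, rec, hrec⟩, hcan,
      fun E _ _ _ _ _ _ => hcanE E⟩
  choose D hD hDE using key
  exact ⟨⟨D, hD, fun v E _ _ _ _ _ _ => hDE v E⟩⟩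

/-- By-name sanity check: the stubs feed the composition as they stand. -/
example : CanonicalReciprocityData :=
  CanonicalReciprocityData_of stub_localLanglandsDatumNonempty stub_canonicalEpsilonSystem stub_localLanglandsGLCanonical

end Summit.Langlands.Langlands.Cruxes.CanonicalReciprocityData.Birth

end
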